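import Summits.QuantumAdvantage.AdviceFreeQNC0.SupportGapPhase
import HarnessLib

/-!
# Cell qa-qnc0 (`p = 3`): E3′ `SupportGapPhase3` — PROOF

Planner qa-qnc0-p1 g15, ROUND-14 §4ter R3 (vi) / `Sketch18.lean` §6 (statement and toolkit in
`SupportGapPhase.lean`).  PROVED here:

* `three_mul_card_segSum_zero_le` — `3·#{s : T_J(s) = 0} ≤ 2ⁿ + 2·2^{n−L}` by the root-of-unity filter and the
  product formula `Σ_s ω^{kT_J(s)} = (−1)^{L}·2^{n−L}` (`Fintype.prod_sum`); hence `sum_flipWeight_le`: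
  `Σ_s |1 + ω^{T_J(s)}|/2 ≤ 2ⁿ·(2/3 + 3⁻¹2^{−L})`;
* `weighted_bound` — the induction on the number `m` of segments, carrying a flip-invariant weight `Φ`
  dominated by a function `B` blind to the segments' spins (one segment is peeled per step by flip averaging,
  `Σ χ(ℓ)Φ = Σ χ(ℓ)·Φ·(1 + χ(T_J))/2`, and the factor is integrated out by `sum_mul_eq_of_blind`);
* **`supportGapPhase3 : SupportGapPhase3`** — for ANY `h : {±1}ⁿ → 𝔽₃` (no degree or range hypothesis)
  invariant under the flips of `m` pairwise disjoint spin segments of length `L`, and any nowhere-zero linear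
  phase `ℓ(s) = Σ_i ε_i s_i`: `|Σ_s ω^{ℓ(s)+h(s)}| ≤ 2ⁿ·(2/3 + 3⁻¹2^{−L})^m`.

Message (planner qa-qnc0-p1): the walk phase cancels wherever the selector is not looking — a successful bell must
watch a boundary bond of every long segment (covers the exact degree-1 optimum of the one-bell game, kit j288189).
WHAT THIS IS NOT: nothing on E3 / `BandPhaseLin3`, on the `p = 3` crux `RingHardOdd 3`, or on R3 `OneBellDWB3`;
separation NOT moved.
-/

noncomputable section

namespace Summit.QuantumAdvantage.AdviceFreeQNC0

open Classical
open Finset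

namespace SupportGap

variable {n : ℕ}

/-! ### Counting the segment sums: `3·#{s : T_J(s) = 0} ≤ 2ⁿ + 2·2^{n-L}` -/

/-- The full character sum of a segment phase: `Σ_s χ(k·T_J(s)) = Π_i (…)`, of norm `2^{n−|J|}` for `k ≠ 0`. -/
theorem norm_sum_chi_segSum (ε : Fin n → ZMod 3) (hε : ∀ i, ε i ≠ 0) (a L : ℕ) {k : ZMod 3} (hk : k ≠ 0) :
    ‖∑ s : Fin n → Bool, chi (k * segSum ε a L s)‖ =
      (2 : ℝ) ^ (univ.filter fun i : Fin n => ¬ (a ≤ i.val ∧ i.val < a + L)).card := by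
  -- write the summand as a product over coordinates
  obtain ⟨f, hf⟩ : ∃ f : Fin n → Bool → ℂ, f = fun i b =>
      if a ≤ i.val ∧ i.val < a + L then chi (k * (ε i * (if b then -1 else 1))) else 1 := ⟨_, rfl⟩
  have hterm : ∀ s : Fin n → Bool, chi (k * segSum ε a L s) = ∏ i, f i (s i) := by
    intro s
    unfold segSum
    rw [Finset.mul_sum, chi_sum]
    refine Finset.prod_congr rfl fun i _ => ?_
    rw [hf]
    dsimp only
    by_cases h : a ≤ i.val ∧ i.val < a + L
    · rw [if_pos h, if_pos h]; rfl
    · rw [if_neg h, if_neg h, mul_zero, chi_zero]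
  have hf_true : ∀ i, f i true = if a ≤ i.val ∧ i.val < a + L then chi (-(k * ε i)) else 1 := by
    intro i; rw [hf]; dsimp only
    by_cases h : a ≤ i.val ∧ i.val < a + L
    · rw [if_pos h, if_pos h]; congr 1; simp
    · rw [if_neg h, if_neg h]
  have hf_false : ∀ i, f i false = if a ≤ i.val ∧ i.val < a + L then chi (k * ε i) else 1 := by
    intro i; rw [hf]; dsimp only
    by_cases h : a ≤ i.val ∧ i.val < a + L
    · rw [if_pos h, if_pos h]; congr 1; simp
    · rw [if_neg h, if_neg h]
  rw [Finset.sum_congr rfl (fun s _ => hterm s), ← Fintype.prod_sum]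
  -- each coordinate factor
  have hfac : ∀ i : Fin n, (∑ b : Bool, f i b) =
      if a ≤ i.val ∧ i.val < a + L then -1 else 2 := by
    intro i
    rw [Fintype.sum_bool, hf_true, hf_false]
    by_cases h : a ≤ i.val ∧ i.val < a + L
    · rw [if_pos h, if_pos h, if_pos h, add_comm]
      exact chi_add_chi_neg (mul_ne_zero hk (hε i))
    · rw [if_neg h, if_neg h, if_neg h]
      norm_num
  rw [Finset.prod_congr rfl (fun i _ => hfac i), norm_prod]
  have hn : ∀ i : Fin n, ‖(if a ≤ i.val ∧ i.val < a + L then (-1 : ℂ) else 2)‖ =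
      if a ≤ i.val ∧ i.val < a + L then (1 : ℝ) else 2 := by
    intro i
    by_cases h : a ≤ i.val ∧ i.val < a + L
    · rw [if_pos h, if_pos h, norm_neg, norm_one]
    · rw [if_neg h, if_neg h, Complex.norm_ofNat]
  rw [Finset.prod_congr rfl (fun i _ => hn i), Finset.prod_ite, Finset.prod_const_one, one_mul,
    Finset.prod_const]

/-- The segment `[a, a+L) ⊆ [0, n)` has exactly `L` spins, so its complement has `n − L`. -/
theorem card_compl_seg {a L : ℕ} (haL : a + L ≤ n) :
    (univ.filter fun i : Fin n => ¬ (a ≤ i.val ∧ i.val < a + L)).card = n - L := by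
  have hJ : (univ.filter fun i : Fin n => a ≤ i.val ∧ i.val < a + L).card = L := by
    have himg : (univ.filter fun i : Fin n => a ≤ i.val ∧ i.val < a + L) =
        Finset.univ.image (fun k : Fin L => (⟨a + k.val, by omega⟩ : Fin n)) := by
      ext i
      simp only [mem_filter, mem_univ, true_and, mem_image]
      constructor
      · rintro ⟨h1, h2⟩
        exact ⟨⟨i.val - a, by omega⟩, Fin.ext (by simp only; omega)⟩
      · rintro ⟨k, rfl⟩
        simp only; omega
    rw [himg, Finset.card_image_of_injective _ (fun k k' hk => by
      have := congrArg Fin.val hk; exact Fin.ext (by simpa using this))]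
    simp
  have htot := Finset.card_filter_add_card_filter_not
    (s := (univ : Finset (Fin n))) (fun i : Fin n => a ≤ i.val ∧ i.val < a + L)
  rw [hJ, card_univ, Fintype.card_fin] at htot
  omega

/-- **`3·#{s : T_J(s) = 0} ≤ 2ⁿ + 2·2^{n−L}`** (root-of-unity filter). -/
theorem three_mul_card_segSum_zero_le (ε : Fin n → ZMod 3) (hε : ∀ i, ε i ≠ 0) {a L : ℕ}
    (haL : a + L ≤ n) :
    3 * ((univ.filter fun s : Fin n → Bool => segSum ε a L s = 0).card : ℝ) ≤
      (2 : ℝ) ^ n + 2 * (2 : ℝ) ^ (n - L) := by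
  -- the filter identity `3·[T = 0] = Σ_k χ(kT)` in `ℂ`
  have hfilter : ∀ T : ZMod 3, (∑ k : ZMod 3, chi (k * T)) = if T = 0 then 3 else 0 := by
    have key : ∀ T : ZMod 3, T = 0 ∨ (T ≠ 0 ∧ ((1 : ZMod 3) * T = T ∧ (2 : ZMod 3) * T = -T)) := by decide
    intro T
    rw [show (univ : Finset (ZMod 3)) = {0, 1, 2} from by decide]
    rw [Finset.sum_insert (by decide), Finset.sum_insert (by decide), Finset.sum_singleton]
    rcases key T with h0 | ⟨hne, h1, h2⟩
    · rw [if_pos h0, h0, mul_zero, mul_zero, mul_zero, chi_zero]; norm_num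
    · rw [if_neg hne, zero_mul, chi_zero, h1, h2, chi_add_chi_neg hne]; norm_num
  have hcount : (3 * ((univ.filter fun s : Fin n → Bool => segSum ε a L s = 0).card : ℂ)) =
      ∑ k : ZMod 3, ∑ s : Fin n → Bool, chi (k * segSum ε a L s) := by
    rw [Finset.sum_comm]
    simp_rw [hfilter]
    rw [Finset.sum_ite, Finset.sum_const_zero, add_zero, Finset.sum_const, nsmul_eq_mul, mul_comm]
  -- split off `k = 0` and bound the two non-trivial character sums
  have hsplit : (∑ k : ZMod 3, ∑ s : Fin n → Bool, chi (k * segSum ε a L s)) =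
      (2 : ℂ) ^ n + ((∑ s : Fin n → Bool, chi (1 * segSum ε a L s)) +
        ∑ s : Fin n → Bool, chi (2 * segSum ε a L s)) := by
    rw [show (univ : Finset (ZMod 3)) = {0, 1, 2} from by decide]
    rw [Finset.sum_insert (by decide), Finset.sum_insert (by decide), Finset.sum_singleton]
    simp only [zero_mul, chi_zero, Finset.sum_const, Finset.card_univ, Fintype.card_fun, Fintype.card_bool,
      Fintype.card_fin, nsmul_eq_mul, mul_one]
    push_cast
    ring
  have h1 := norm_sum_chi_segSum ε hε a L (k := 1) (by decide)
  have h2 := norm_sum_chi_segSum ε hε a L (k := 2) (by decide)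
  rw [card_compl_seg haL] at h1 h2
  have hreal : (3 * ((univ.filter fun s : Fin n → Bool => segSum ε a L s = 0).card : ℝ)) =
      ‖(3 * ((univ.filter fun s : Fin n → Bool => segSum ε a L s = 0).card : ℂ))‖ := by
    rw [show (3 * ((univ.filter fun s : Fin n → Bool => segSum ε a L s = 0).card : ℂ)) =
      ((3 * (univ.filter fun s : Fin n → Bool => segSum ε a L s = 0).card : ℕ) : ℂ) by push_cast; ring]
    rw [Complex.norm_natCast]; push_cast; ring
  rw [hreal, hcount, hsplit]
  calc ‖(2 : ℂ) ^ n + ((∑ s : Fin n → Bool, chi (1 * segSum ε a L s)) +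
        ∑ s : Fin n → Bool, chi (2 * segSum ε a L s))‖
      ≤ ‖(2 : ℂ) ^ n‖ + (‖∑ s : Fin n → Bool, chi (1 * segSum ε a L s)‖ +
        ‖∑ s : Fin n → Bool, chi (2 * segSum ε a L s)‖) :=
        le_trans (norm_add_le _ _) (add_le_add le_rfl (norm_add_le _ _))
    _ = (2 : ℝ) ^ n + 2 * (2 : ℝ) ^ (n - L) := by
        rw [h1, h2, norm_pow, Complex.norm_ofNat]; ring

/-- Hence the average of `|1 + χ(T_J)|/2` is at most `2/3 + 3⁻¹2^{-L}`:
`Σ_s (if T_J(s) = 0 then 1 else 1/2) ≤ 2ⁿ·(2/3 + 3⁻¹·2^{-L})`. -/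
theorem sum_flipWeight_le (ε : Fin n → ZMod 3) (hε : ∀ i, ε i ≠ 0) {a L : ℕ} (haL : a + L ≤ n) :
    (∑ s : Fin n → Bool, (if segSum ε a L s = 0 then (1 : ℝ) else 1 / 2)) ≤
      (2 : ℝ) ^ n * (2 / 3 + 3⁻¹ * (2⁻¹ : ℝ) ^ L) := by
  have hsum : (∑ s : Fin n → Bool, (if segSum ε a L s = 0 then (1 : ℝ) else 1 / 2)) =
      (2 : ℝ) ^ n / 2 + ((univ.filter fun s : Fin n → Bool => segSum ε a L s = 0).card : ℝ) / 2 := by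
    have hpt : ∀ s : Fin n → Bool, (if segSum ε a L s = 0 then (1 : ℝ) else 1 / 2) =
        1 / 2 + (if segSum ε a L s = 0 then (1 / 2 : ℝ) else 0) := by
      intro s; split_ifs <;> norm_num
    simp_rw [hpt]
    rw [Finset.sum_add_distrib, Finset.sum_const, Finset.card_univ, Fintype.card_fun, Fintype.card_bool,
      Fintype.card_fin, nsmul_eq_mul, Finset.sum_ite, Finset.sum_const_zero, add_zero, Finset.sum_const,
      nsmul_eq_mul]
    push_cast
    ring
  have hc := three_mul_card_segSum_zero_le ε hε haL
  have hL : (2 : ℝ) ^ (n - L) = (2 : ℝ) ^ n * (2⁻¹ : ℝ) ^ L := by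
    have hLn : L ≤ n := by omega
    rw [inv_pow, ← div_eq_mul_inv, eq_div_iff (by positivity), ← pow_add, Nat.sub_add_cancel hLn]
  rw [hsum]
  rw [hL] at hc
  nlinarith [hc, pow_pos (show (0:ℝ) < 2 by norm_num) n, pow_pos (show (0:ℝ) < 2⁻¹ by norm_num) L]

/-! ### The induction on the number of segments -/

/-- **Flip averaging with a weight, `m` segments**: for `Φ` invariant under the flips of the `m` disjoint
segments, dominated by a non-negative `B` that is blind to the spins of all the segments,
`‖Σ_s χ(ℓ(s))·Φ(s)‖ ≤ (2/3 + 3⁻¹2^{-L})^m · Σ_s B(s)`. -/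
theorem weighted_bound (L : ℕ) (ε : Fin n → ZMod 3) (hε : ∀ i, ε i ≠ 0) :
    ∀ (m : ℕ) (a : Fin m → ℕ), (∀ j, a j + L ≤ n) → (∀ j j', j ≠ j' → a j + L ≤ a j' ∨ a j' + L ≤ a j) →
    ∀ (Φ : (Fin n → Bool) → ℂ) (B : (Fin n → Bool) → ℝ),
      (∀ j s, Φ (segFlip (a j) L s) = Φ s) → (∀ s, ‖Φ s‖ ≤ B s) →
      (∀ s s' : Fin n → Bool,
        (∀ i : Fin n, (¬ ∃ j, a j ≤ i.val ∧ i.val < a j + L) → s i = s' i) → B s = B s') →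
      ‖∑ s, chi (∑ i, ε i * sgnOf s i) * Φ s‖ ≤ (2 / 3 + 3⁻¹ * (2⁻¹ : ℝ) ^ L) ^ m * ∑ s, B s := by
  intro m
  induction m with
  | zero =>
    intro a _ _ Φ B _ hΦB _
    rw [pow_zero, one_mul]
    refine le_trans (norm_sum_le _ _) (Finset.sum_le_sum fun s _ => ?_)
    rw [norm_mul, norm_chi, one_mul]
    exact hΦB s
  | succ m ih =>
    intro a ha hdis Φ B hΦ hΦB hB
    -- the last segment `J = [a (last m), a (last m) + L)` and the first `m` segments `a ∘ castSucc`
    have ha' : ∀ j : Fin m, a j.castSucc + L ≤ n := fun j => ha _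
    have hdis' : ∀ j j' : Fin m, j ≠ j' →
        a j.castSucc + L ≤ a j'.castSucc ∨ a j'.castSucc + L ≤ a j.castSucc := fun j j' hjj' =>
      hdis _ _ (fun h => hjj' (Fin.castSucc_injective _ h))
    have hdisJ : ∀ j : Fin m, a j.castSucc + L ≤ a (Fin.last m) ∨ a (Fin.last m) + L ≤ a j.castSucc :=
      fun j => hdis _ _ (fun h => (Fin.castSucc_lt_last j).ne h)
    -- abbreviations: the segment sum `T`, the averaged weight `Φ'`, its dominating function `B'`
    obtain ⟨T, hT⟩ : ∃ T : (Fin n → Bool) → ZMod 3, T = segSum ε (a (Fin.last m)) L := ⟨_, rfl⟩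
    obtain ⟨Φ', hΦ'⟩ : ∃ Φ' : (Fin n → Bool) → ℂ, Φ' = fun s => Φ s * ((1 + chi (T s)) / 2) := ⟨_, rfl⟩
    obtain ⟨B', hB'⟩ : ∃ B' : (Fin n → Bool) → ℝ,
        B' = fun s => B s * (if T s = 0 then (1 : ℝ) else 1 / 2) := ⟨_, rfl⟩
    -- Step A: flip averaging on `J`
    have hflip : (∑ s, chi (∑ i, ε i * sgnOf s i) * Φ s) = ∑ s, chi (∑ i, ε i * sgnOf s i) * Φ' s := by
      have hinv : Function.Involutive (segFlip (n := n) (a (Fin.last m)) L) :=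
        segFlip_segFlip (a (Fin.last m)) L
      have hre : (∑ s, chi (∑ i, ε i * sgnOf s i) * Φ s) =
          ∑ s, chi (∑ i, ε i * sgnOf (segFlip (a (Fin.last m)) L s) i) *
            Φ (segFlip (a (Fin.last m)) L s) :=
        (Equiv.sum_comp hinv.toPerm (fun s => chi (∑ i, ε i * sgnOf s i) * Φ s)).symm
      have hre' : (∑ s, chi (∑ i, ε i * sgnOf (segFlip (a (Fin.last m)) L s) i) *
            Φ (segFlip (a (Fin.last m)) L s)) =
          ∑ s, chi (∑ i, ε i * sgnOf s i) * chi (T s) * Φ s := by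
        refine Finset.sum_congr rfl fun s _ => ?_
        rw [linPhase_segFlip, chi_add, hΦ (Fin.last m) s, hT]
      have h2 : (2 : ℂ) * (∑ s, chi (∑ i, ε i * sgnOf s i) * Φ s) =
          ∑ s, chi (∑ i, ε i * sgnOf s i) * Φ s * (1 + chi (T s)) := by
        rw [two_mul]
        nth_rewrite 2 [hre.trans hre']
        rw [← Finset.sum_add_distrib]
        refine Finset.sum_congr rfl fun s _ => ?_
        ring
      have h2' : (∑ s, chi (∑ i, ε i * sgnOf s i) * Φ s) =
          (∑ s, chi (∑ i, ε i * sgnOf s i) * Φ s * (1 + chi (T s))) / 2 := by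
        rw [← h2]; ring
      rw [h2', Finset.sum_div]
      refine Finset.sum_congr rfl fun s _ => ?_
      rw [hΦ']
      ring
    -- the new weight is invariant under the first `m` flips and dominated by `B' = B·|1+χ(T)|/2`
    have hΦ'inv : ∀ (j : Fin m) (s : Fin n → Bool), Φ' (segFlip (a j.castSucc) L s) = Φ' s := by
      intro j s
      rw [hΦ']
      show Φ (segFlip (a j.castSucc) L s) * ((1 + chi (T (segFlip (a j.castSucc) L s))) / 2) =
        Φ s * ((1 + chi (T s)) / 2)
      rw [hΦ j.castSucc s, hT, segSum_segFlip_of_disjoint ε (hdisJ j).symm s]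
    have hΦ'B' : ∀ s, ‖Φ' s‖ ≤ B' s := by
      intro s
      rw [hΦ', hB']
      show ‖Φ s * ((1 + chi (T s)) / 2)‖ ≤ B s * (if T s = 0 then (1 : ℝ) else 1 / 2)
      rw [norm_mul, norm_div, Complex.norm_ofNat, norm_one_add_chi]
      have hB0 : 0 ≤ B s := le_trans (norm_nonneg _) (hΦB s)
      refine mul_le_mul (hΦB s) ?_ (by positivity) hB0
      split_ifs <;> norm_num
    have hB'blind : ∀ s s' : Fin n → Bool,
        (∀ i : Fin n, (¬ ∃ j : Fin m, a j.castSucc ≤ i.val ∧ i.val < a j.castSucc + L) → s i = s' i) →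
          B' s = B' s' := by
      intro s s' hss'
      rw [hB']
      show B s * (if T s = 0 then (1 : ℝ) else 1 / 2) = B s' * (if T s' = 0 then (1 : ℝ) else 1 / 2)
      have hBeq : B s = B s' := hB s s' (fun i hi => hss' i (fun ⟨j, hj⟩ => hi ⟨j.castSucc, hj⟩))
      have hTeq : T s = T s' := by
        rw [hT]
        refine segSum_congr ε (a (Fin.last m)) L (fun i hi => hss' i ?_)
        rintro ⟨j, hj⟩
        rcases hdisJ j with h | h <;> omega
      rw [hBeq, hTeq]
    -- induction hypothesis on the first `m` segments
    have hIH := ih (fun j => a j.castSucc) ha' hdis' Φ' B' hΦ'inv hΦ'B' hB'blind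
    rw [hflip]
    refine le_trans hIH ?_
    -- Step C: factorise `Σ B·c/2 = 2^{-n} (Σ B)(Σ c/2) ≤ r · Σ B`
    have hfact := sum_mul_eq_of_blind (a (Fin.last m)) L B (fun s => if T s = 0 then (1 : ℝ) else 1 / 2)
      (fun s s' hss' => hB s s' (fun i hi => hss' i (fun h => hi ⟨Fin.last m, h⟩)))
      (fun s s' hss' => by
        have hTeq : T s = T s' := by rw [hT]; exact segSum_congr ε (a (Fin.last m)) L hss'
        simp only [hTeq])
    have hw := sum_flipWeight_le ε hε (ha (Fin.last m))
    rw [← hT] at hw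
    have hBsum : 0 ≤ ∑ s, B s := Finset.sum_nonneg fun s _ => le_trans (norm_nonneg _) (hΦB s)
    have hr : 0 ≤ (2 / 3 + 3⁻¹ * (2⁻¹ : ℝ) ^ L) := by positivity
    have h2n : (0 : ℝ) < (2 : ℝ) ^ n := by positivity
    have hkey : (∑ s, B' s) ≤ (2 / 3 + 3⁻¹ * (2⁻¹ : ℝ) ^ L) * ∑ s, B s := by
      have : (2 : ℝ) ^ n * (∑ s, B' s) ≤ (2 : ℝ) ^ n * ((2 / 3 + 3⁻¹ * (2⁻¹ : ℝ) ^ L) * ∑ s, B s) := by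
        rw [hB', hfact]
        calc (∑ s, B s) * (∑ s, if T s = 0 then (1 : ℝ) else 1 / 2)
            ≤ (∑ s, B s) * ((2 : ℝ) ^ n * (2 / 3 + 3⁻¹ * (2⁻¹ : ℝ) ^ L)) :=
              mul_le_mul_of_nonneg_left hw hBsum
          _ = (2 : ℝ) ^ n * ((2 / 3 + 3⁻¹ * (2⁻¹ : ℝ) ^ L) * ∑ s, B s) := by ring
      exact le_of_mul_le_mul_left this h2n
    calc (2 / 3 + 3⁻¹ * (2⁻¹ : ℝ) ^ L) ^ m * ∑ s, B' s
        ≤ (2 / 3 + 3⁻¹ * (2⁻¹ : ℝ) ^ L) ^ m * ((2 / 3 + 3⁻¹ * (2⁻¹ : ℝ) ^ L) * ∑ s, B s) :=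
          mul_le_mul_of_nonneg_left hkey (pow_nonneg hr m)
      _ = (2 / 3 + 3⁻¹ * (2⁻¹ : ℝ) ^ L) ^ (m + 1) * ∑ s, B s := by ring

end SupportGap

/-! ### E3′ -/

open SupportGap in
/-- **E3′ `SupportGapPhase3` — PROVED**: a nowhere-zero linear walk phase, twisted by ANY function blind to the
flips of `m` disjoint spin segments of length `L`, has exponential sum at most `2ⁿ·(2/3 + 3⁻¹2^{-L})^m`. -/
theorem supportGapPhase3 : SupportGapPhase3 := by
  intro n L m ε hε a ha hdis h hh
  have hZ : bandSum ε h = ∑ s, chi (∑ i, ε i * sgnOf s i) * chi (h s) := by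
    unfold bandSum
    refine Finset.sum_congr rfl fun s _ => ?_
    rw [← chi_add]; rfl
  rw [hZ]
  have hb := weighted_bound (n := n) L ε hε m a ha hdis (fun s => chi (h s)) (fun _ => 1)
    (fun j s => by show chi (h (segFlip (a j) L s)) = chi (h s); rw [hh j s])
    (fun s => by show ‖chi (h s)‖ ≤ 1; rw [norm_chi]) (fun _ _ _ => rfl)
  refine le_trans hb (le_of_eq ?_)
  rw [Finset.sum_const, Finset.card_univ, Fintype.card_fun, Fintype.card_bool, Fintype.card_fin,
    nsmul_eq_mul, mul_one]
  push_cast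
  ring

end Summit.QuantumAdvantage.AdviceFreeQNC0

end
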